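import Summits.ABC.ABC.Theses.PadicPrimesKummerThird
import Summits.ABC.StewartYu.YuOhSevenTransferOdd
import Summits.ABC.StewartYu.YuOhSevenTransferTwo

set_option linter.dupNamespace false

/-!
# Route PadicPrimesKummerThird (rung F-A1 = Stewart–Yu 2001): the two TRANSFER stubs BY NAME

`Summits/ABC/ABC/Theorems/PadicPrimesKummerThirdTransfers.lean` — cell `abc-stewartyu`, seat p3 (g4).
The registered BC3 skeletons of the cruxes `Y07Odd` (stmt-ABC-19658) and `Y07Two` (stmt-ABC-19659)
(plan-m3 g0, `bc/Y07Odd_birth.lean` / `bc/Y07Two_birth.lean`, E07 texts frozen 2026-08-26T13:24:59Z) carry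
the stubs `stub_transferOdd : GenThreeEngineOdd → Y07Odd` and `stub_transferTwo : GenThreeEngineTwo → Y07Two`.
Both are PROVED cell-side: p2-g3's `Summit.ABC.StewartYu.YuOhSeven.y07Odd_of_genThreeEngineOdd` (p448120) and
p1-g5's `Summit.ABC.StewartYu.YuOhSeven.y07Two_of_genThreeEngineTwo` (p448450), each against the frozen engine
text with `c₆ = 3c₁` (`αⱼ = qⱼ` resp. `αⱼ = qⱼ²`).  This file re-exports them with the crux decls BY NAME
as conclusions, the engine texts verbatim as hypotheses.  [folklore]
WHAT THIS IS NOT: not the engines (`stub_engineOdd` / `stub_engineTwo`, XL) and not the shared zero estimate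
`stub_zeroEstimate : Nesterenko2003_prop51` (p5-g2).
-/

namespace Summit.ABC.ABC.Theorems

open Summit.ABC.ABC.Theses.PadicPrimesKummerThird

/-- **`stub_transferOdd` of crux `Y07Odd` (stmt-ABC-19658), by name**: the Gen-3 unit-form engine text at odd
`p` (frozen `GenThreeEngineOdd`) implies the crux, `c₆ = 3c₁` (p2-g3's `YuOhSeven.y07Odd_of_genThreeEngineOdd`).
[folklore] -/
theorem padicPrimesKummerThird_y07Odd_of_genThreeEngineOdd
    (hE : ∃ (C : ℕ → ℝ) (c₁ : ℝ), 1 ≤ c₁ ∧ (∀ m, 0 ≤ C m ∧ C m ≤ c₁ ^ m) ∧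
      ∀ (p : ℕ), p.Prime → p ≠ 2 → ∀ (m : ℕ) (α : Fin m → ℚ) (b : Fin m → ℤ) (V : Fin m → ℝ)
        (Vmax W : ℝ),
        (∀ j, α j ≠ 0 ∧ padicValRat p (α j) = 0) →
        (∀ μ : Fin m → ℤ, ∏ j, α j ^ μ j = 1 → μ = 0) →
        (∀ T : Finset (Fin m), T.Nonempty → ¬ IsSquare (∏ j ∈ T, α j) ∧ ¬ IsSquare (-∏ j ∈ T, α j)) →
        (∀ j, Height.logHeight₁ (α j) ≤ V j) → (∀ j, Real.log 2 ≤ V j) → (∀ j, V j ≤ Vmax) →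
        b ≠ 0 → (∀ j, Real.log (max 3 (|b j| : ℝ)) ≤ W) →
        (padicValRat p (∏ j, α j ^ b j - 1) : ℝ) * Real.log p ≤
          C m * ((p : ℝ) / Real.log p) * (∏ j, V j) * (W + Real.log p + Real.log (2 * Vmax))) :
    Y07Odd :=
  Summit.ABC.StewartYu.YuOhSeven.y07Odd_of_genThreeEngineOdd hE

/-- **`stub_transferTwo` of crux `Y07Two` (stmt-ABC-19659), by name**: the Gen-3 `2`-adic engine text
(frozen `GenThreeEngineTwo`: integer generators `≡ 1 (mod 8)`, cube-Kummer) implies the crux, `c₆ = 3c₁`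
(p1-g5's `YuOhSeven.y07Two_of_genThreeEngineTwo`). [folklore] -/
theorem padicPrimesKummerThird_y07Two_of_genThreeEngineTwo
    (hE : ∃ (C : ℕ → ℝ) (c₁ : ℝ), 1 ≤ c₁ ∧ (∀ m, 0 ≤ C m ∧ C m ≤ c₁ ^ m) ∧
      ∀ (m : ℕ) (α : Fin m → ℚ) (b : Fin m → ℤ) (V : Fin m → ℝ) (Vmax W : ℝ),
        (∀ j, ∃ a : ℤ, α j = a) →
        (∀ j, 3 ≤ padicValRat 2 (α j - 1)) →
        (∀ μ : Fin m → ℤ, ∏ j, α j ^ μ j = 1 → μ = 0) →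
        (∀ κ : Fin m → ℕ, (∃ j, ¬ 3 ∣ κ j) → ∀ γ : ℚ, ∏ j, α j ^ κ j ≠ γ ^ 3) →
        (∀ j, Height.logHeight₁ (α j) ≤ V j) → (∀ j, 1 ≤ V j) → (∀ j, V j ≤ Vmax) →
        b ≠ 0 → (∀ j, Real.log (max 3 (|b j| : ℝ)) ≤ W) → 1 ≤ W →
        (padicValRat 2 (∏ j, α j ^ b j - 1) : ℝ) ≤ C m * (∏ j, V j) * (W + Real.log (2 * Vmax))) :
    Y07Two :=
  Summit.ABC.StewartYu.YuOhSeven.y07Two_of_genThreeEngineTwo hE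

end Summit.ABC.ABC.Theorems
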